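import Summits.Ventures.PercRepro.S1CellCaps
import Summits.Ventures.PercRepro.S1CellSub
import Summits.Ventures.PercRepro.S1LevelFourI

/-!
# PercRepro — S1 ROW `12` MODULO THE COMPUTED CAPS (p2, gen 16; SUBCLAIM-S1 §6.3 (ix))

The core of rank `12`: `(12, 5)` needs `s₃ ≤ 7` and `s₄ ≤ 29`, `(12, 6)` needs `s₄ ≤ 45` (the computed caps — not
Lean theorems; hypotheses here), `(12, 7)` and `(12, 8)` are the unconditional sub-case cells (`S1CellSub`), and
`d ≥ 9` is `cellOK8` (tables + the tail through `C(n, 11)`).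

* `pow_le_factorial_mul_choose_eleven`, `tailM12`, `cellOK8_of_tail_ineq` (symbolic `p`), `cellOK8_of_tail12`, `table_12_9_15`, `table_12_16_100` …
  `table_12_301_400`, `table_12_9_400`;
* **`c025_core_four_twelve_of_caps`** — the core of rank `12` under the cap hypotheses;
* **`c025_four_twelve_fixed_of_caps`**, **`c025_four_twelve_of_caps`** — level `4` at `p = 12` / every `p ≥ 12` modulo the caps.
Axioms: standard.
-/

open scoped Matroid

namespace PercRepro

namespace S1

open Set

variable {α : Type}

/-- `11! · C(n, 11) ≥ (n − 10)^11`. -/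
theorem pow_le_factorial_mul_choose_eleven (n : ℕ) : (n + 1 - 11) ^ 11 ≤ Nat.factorial 11 * n.choose 11 := by
  rw [← Nat.descFactorial_eq_factorial_mul_choose]
  exact Nat.pow_sub_le_descFactorial n 11

/-- The tail inequalities (flat-profile form at `d ≥ 8`, per-flat `U`, `R₃` at `7/5`) for `p = 12`, `d ≥ 401`. -/
theorem tailM12 (p d : ℕ) (hp : 12 ≤ p) (hp' : p ≤ 12) (hd : 401 ≤ d) :
    10584 * (min (d * (d + 1) / 2) ((d * d + 6 - 3 * d) / 2) * (p + d - 3) + min (min ((d + 3).choose 4) (d * (d + 1) * (d + 2) / 3)) (fourCircuitBound d)) +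
        (RSK 10 * (min (d * (d + 1) / 2) ((d * d + 6 - 3 * d) / 2) * (p + d - 3).choose 2 + min (min ((d + 3).choose 4) (d * (d + 1) * (d + 2) / 3)) (fourCircuitBound d) * (p + d - 4) + (d + 4).choose 5) +
          (RBK 10 - RSK 10) * (min (d * (d + 1) / 2) ((d * d + 6 - 3 * d) / 2) * (min (5 * d) (p + d) - 3).choose 2 + min (min ((d + 3).choose 4) (d * (d + 1) * (d + 2) / 3)) (fourCircuitBound d) * (min (5 * d) (p + d) - 4) + (d + 4).choose 5)) ≤
      7560 * ∑ j ∈ Finset.Ico 5 p, (p + d).choose j ∧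
    (2 ^ (p + 4) - 2 * ∑ u ∈ Finset.range 5, (p + 4).choose u) *
        (7560 * (p + d).choose 4 +
          (RSK d * (p + d - 3).choose 2 + (RBK d - RSK d) * (min (5 * d) (p + d) - 3).choose 2 - 7560 * (p + d - 3)) *
            min (d * (d + 1) / 2) ((d * d + 6 - 3 * d) / 2) +
          (RSK d * (p + d - 4) + (RBK d - RSK d) * (min (5 * d) (p + d) - 4) - 7560) *
            min (min ((d + 3).choose 4) (d * (d + 1) * (d + 2) / 3)) (fourCircuitBound d) +
          (RSK d + (RBK d - RSK d)) * (d + 4).choose 5) +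
      (p + 4).choose 4 *
        (10584 * (min (d * (d + 1) / 2) ((d * d + 6 - 3 * d) / 2) * (p + d - 3) + min (min ((d + 3).choose 4) (d * (d + 1) * (d + 2) / 3)) (fourCircuitBound d)) +
          (RSK 10 * (min (d * (d + 1) / 2) ((d * d + 6 - 3 * d) / 2) * (p + d - 3).choose 2 + min (min ((d + 3).choose 4) (d * (d + 1) * (d + 2) / 3)) (fourCircuitBound d) * (p + d - 4) + (d + 4).choose 5) +
            (RBK 10 - RSK 10) * (min (d * (d + 1) / 2) ((d * d + 6 - 3 * d) / 2) * (min (5 * d) (p + d) - 3).choose 2 + min (min ((d + 3).choose 4) (d * (d + 1) * (d + 2) / 3)) (fourCircuitBound d) * (min (5 * d) (p + d) - 4) + (d + 4).choose 5))) ≤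
      (p + 4).choose 4 * (7560 * ∑ j ∈ Finset.Ico 5 p, (p + d).choose j) := by
  set n := p + d with hn
  set m := min (5 * d) n with hm
  set s4 := min (min ((d + 3).choose 4) (d * (d + 1) * (d + 2) / 3)) (fourCircuitBound d) with hs4def
  -- the crude bounds
  set s3 := min (d * (d + 1) / 2) ((d * d + 6 - 3 * d) / 2) with hs3def
  have hs3 : s3 ≤ n * n := by
    have h0 : s3 ≤ d * (d + 1) / 2 := min_le_left _ _
    have : d * (d + 1) / 2 ≤ d * (d + 1) := Nat.div_le_self _ _
    have : d * (d + 1) ≤ n * n := Nat.mul_le_mul (by omega) (by omega)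
    omega
  have hs4 : s4 ≤ n ^ 4 :=
    ((min_le_left _ _).trans (min_le_left _ _)).trans ((choose_le_pow' _ _).trans (Nat.pow_le_pow_left (by omega) 4))
  have hs5 : (d + 4).choose 5 ≤ n ^ 5 := (choose_le_pow' _ _).trans (Nat.pow_le_pow_left (by omega) 5)
  have hc2 : (n - 3).choose 2 ≤ n ^ 2 := (choose_le_pow' _ _).trans (Nat.pow_le_pow_left (by omega) 2)
  have hc4 : n.choose 4 ≤ n ^ 4 := choose_le_pow' _ _
  have hm5 : m ≤ 5 * n := (min_le_left _ _).trans (by omega)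
  have hm4 : m - 4 ≤ 5 * n := by omega
  have hcm : (m - 3).choose 2 ≤ 25 * n ^ 2 := by
    have h1 : (m - 3).choose 2 ≤ (m - 3) ^ 2 := choose_le_pow' _ _
    have h2 : (m - 3) ^ 2 ≤ (5 * n) ^ 2 := Nat.pow_le_pow_left (by omega) 2
    have h3 : (5 * n) ^ 2 = 25 * n ^ 2 := by ring
    omega
  have hn1 : 1 ≤ n := by omega
  have hn45 : n ^ 4 ≤ n ^ 5 := Nat.pow_le_pow_right hn1 (by norm_num)
  have hn25 : n ^ 2 ≤ n ^ 5 := Nat.pow_le_pow_right hn1 (by norm_num)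
  have hnn : n * n = n ^ 2 := by ring
  have hpiAll : s3 * (n - 3).choose 2 + s4 * (n - 4) + (d + 4).choose 5 ≤ 3 * n ^ 5 := by
    have h1 : s3 * (n - 3).choose 2 ≤ n ^ 2 * n ^ 2 := Nat.mul_le_mul (by rw [← hnn]; exact hs3) hc2
    have h2 : s4 * (n - 4) ≤ n ^ 4 * n := Nat.mul_le_mul hs4 (by omega)
    have h3 : n ^ 2 * n ^ 2 = n ^ 4 := by ring
    have h4 : n ^ 4 * n = n ^ 5 := by ring
    omega
  have hpiS0 : s3 * (m - 3).choose 2 + s4 * (m - 4) + (d + 4).choose 5 ≤ 31 * n ^ 5 := by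
    have h1 : s3 * (m - 3).choose 2 ≤ n ^ 2 * (25 * n ^ 2) := Nat.mul_le_mul (by rw [← hnn]; exact hs3) hcm
    have h2 : s4 * (m - 4) ≤ n ^ 4 * (5 * n) := Nat.mul_le_mul hs4 hm4
    have h3 : n ^ 2 * (25 * n ^ 2) = 25 * n ^ 4 := by ring
    have h4 : n ^ 4 * (5 * n) = 5 * n ^ 5 := by ring
    omega
  have hR3 : 10584 * (s3 * (n - 3) + s4) ≤ 21168 * n ^ 5 := by
    have h1 : s3 * (n - 3) ≤ n ^ 2 * n := Nat.mul_le_mul (by rw [← hnn]; exact hs3) (by omega)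
    have h2 : n ^ 2 * n = n ^ 3 := by ring
    have h3 : n ^ 3 ≤ n ^ 5 := Nat.pow_le_pow_right hn1 (by norm_num)
    omega
  have hRS := RSK_le d
  have hRB : RBK d - RSK d ≤ 24930 := (Nat.sub_le _ _).trans (RBK_le d)
  have hRS10 : RSK 10 = 11592 := by decide
  have hRB10 : RBK 10 - RSK 10 = 13338 := by decide
  set piAll := s3 * (n - 3).choose 2 + s4 * (n - 4) + (d + 4).choose 5 with hpiAll_def
  set piS0 := s3 * (m - 3).choose 2 + s4 * (m - 4) + (d + 4).choose 5 with hpiS0_def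
  set A3 := RSK d * (n - 3).choose 2 + (RBK d - RSK d) * (m - 3).choose 2 with hA3
  set A4 := RSK d * (n - 4) + (RBK d - RSK d) * (m - 4) with hA4
  have hA3le : A3 ≤ 11592 * n ^ 2 + 24930 * (25 * n ^ 2) := by
    rw [hA3]
    exact Nat.add_le_add (Nat.mul_le_mul hRS hc2) (Nat.mul_le_mul hRB hcm)
  have hA4le : A4 ≤ 11592 * n + 24930 * (5 * n) := by
    rw [hA4]
    exact Nat.add_le_add (Nat.mul_le_mul hRS (by omega)) (Nat.mul_le_mul hRB hm4)
  have hc3 : A3 - 7560 * (n - 3) ≤ A3 := Nat.sub_le _ _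
  have hc4' : A4 - 7560 ≤ A4 := Nat.sub_le _ _
  have hc5 : RSK d + (RBK d - RSK d) ≤ 36522 := by omega
  have hU : 7560 * n.choose 4 + (A3 - 7560 * (n - 3)) * s3 + (A4 - 7560) * s4 +
      (RSK d + (RBK d - RSK d)) * (d + 4).choose 5 ≤ 815166 * n ^ 5 := by
    have h1 : (A3 - 7560 * (n - 3)) * s3 ≤ (11592 * n ^ 2 + 24930 * (25 * n ^ 2)) * (n * n) :=
      Nat.mul_le_mul (hc3.trans hA3le) hs3
    have h2 : (A4 - 7560) * s4 ≤ (11592 * n + 24930 * (5 * n)) * n ^ 4 :=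
      Nat.mul_le_mul (hc4'.trans hA4le) hs4
    have h3 : (RSK d + (RBK d - RSK d)) * (d + 4).choose 5 ≤ 36522 * n ^ 5 := Nat.mul_le_mul hc5 hs5
    have h4 : 7560 * n.choose 4 ≤ 7560 * n ^ 5 := Nat.mul_le_mul_left _ (hc4.trans hn45)
    have e1 : (11592 * n ^ 2 + 24930 * (25 * n ^ 2)) * (n * n) = 634842 * n ^ 4 := by ring
    have e2 : (11592 * n + 24930 * (5 * n)) * n ^ 4 = 136242 * n ^ 5 := by ring
    have h5 : 634842 * n ^ 4 ≤ 634842 * n ^ 5 := Nat.mul_le_mul_left _ hn45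
    omega
  have hR4 : RSK 10 * piAll + (RBK 10 - RSK 10) * piS0 ≤ 448254 * n ^ 5 := by
    rw [hRB10, hRS10]
    have h1 : 11592 * piAll ≤ 11592 * (3 * n ^ 5) := Nat.mul_le_mul_left _ hpiAll
    have h2 : 13338 * piS0 ≤ 13338 * (31 * n ^ 5) := Nat.mul_le_mul_left _ hpiS0
    omega
  -- the `Y`-side: one binomial suffices
  have hY : 7560 * n.choose 11 ≤ 7560 * ∑ j ∈ Finset.Ico 5 p, n.choose j := by
    apply Nat.mul_le_mul_left
    exact Finset.single_le_sum (f := fun j => n.choose j) (fun _ _ => Nat.zero_le _)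
      (Finset.mem_Ico.2 ⟨by norm_num, by omega⟩)
  have hdesc := pow_le_factorial_mul_choose_eleven n
  have hn11 : n + 1 - 11 = n - 10 := by omega
  rw [hn11] at hdesc
  have hfact : Nat.factorial 11 = 39916800 := by decide
  rw [hfact] at hdesc
  -- `n ≤ 2 (n − 10)`, `n − 10 ≥ 403`
  have hmn : n ^ 5 ≤ 32 * (n - 10) ^ 5 := by
    have h1 : n ≤ 2 * (n - 10) := by omega
    have h2 : n ^ 5 ≤ (2 * (n - 10)) ^ 5 := Nat.pow_le_pow_left h1 5
    have h3 : (2 * (n - 10)) ^ 5 = 32 * (n - 10) ^ 5 := by ring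
    omega
  have h402 : 402 ^ 6 ≤ (n - 10) ^ 6 := Nat.pow_le_pow_left (by omega) 6
  have hsplit : (n - 10) ^ 11 = (n - 10) ^ 6 * (n - 10) ^ 5 := by ring
  -- `Φ`'s numerator and denominator
  have hphiNum : 2 ^ (p + 4) - 2 * ∑ u ∈ Finset.range 5, (p + 4).choose u ≤ 65536 := by
    have h1 : 2 ^ (p + 4) ≤ 2 ^ 16 := Nat.pow_le_pow_right (by norm_num) (by omega)
    have h2 : (2 : ℕ) ^ 16 = 65536 := by norm_num
    omega
  have hDenU : (p + 4).choose 4 ≤ 1820 := by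
    have h12 : p = 12 := by omega
    subst h12; decide
  have hDenL : 1820 ≤ (p + 4).choose 4 := by
    have h12 : p = 12 := by omega
    subst h12; decide
  -- the key numeric inequality
  obtain ⟨K, hK⟩ : ∃ K : ℕ, K = 65536 * 815166 + 1820 * (21168 + 448254) := ⟨_, rfl⟩
  have hkey : K * 39916800 * 32 ≤ 1820 * 7560 * 402 ^ 6 := by rw [hK]; norm_num
  -- `K · n^5 ≤ 1820 · 7560 · C(n, 11)`
  have hYbig : K * n ^ 5 ≤ 1820 * (7560 * n.choose 11) := by
    have h1 : K * n ^ 5 * 39916800 ≤ 1820 * 7560 * ((n - 10) ^ 6 * (n - 10) ^ 5) := by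
      calc K * n ^ 5 * 39916800
          ≤ K * (32 * (n - 10) ^ 5) * 39916800 := by gcongr
        _ = (K * 39916800 * 32) * (n - 10) ^ 5 := by ring
        _ ≤ (1820 * 7560 * 402 ^ 6) * (n - 10) ^ 5 := Nat.mul_le_mul_right _ hkey
        _ ≤ (1820 * 7560 * (n - 10) ^ 6) * (n - 10) ^ 5 := by gcongr
        _ = 1820 * 7560 * ((n - 10) ^ 6 * (n - 10) ^ 5) := by ring
    rw [← hsplit] at h1
    have h2 : 1820 * 7560 * (n - 10) ^ 11 ≤ 1820 * 7560 * (39916800 * n.choose 11) :=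
      Nat.mul_le_mul_left _ hdesc
    have h3 : K * n ^ 5 * 39916800 ≤ 1820 * (7560 * n.choose 11) * 39916800 := by
      calc _ ≤ 1820 * 7560 * (39916800 * n.choose 11) := h1.trans h2
        _ = 1820 * (7560 * n.choose 11) * 39916800 := by ring
    exact Nat.le_of_mul_le_mul_right h3 (by norm_num)
  have hR34 : 10584 * (s3 * (n - 3) + s4) + (RSK 10 * piAll + (RBK 10 - RSK 10) * piS0) ≤
      (21168 + 448254) * n ^ 5 := by omega
  constructor
  · -- (I1): `R₃ + R₄ ≤ Ysum`
    have h2 : (21168 + 448254) * n ^ 5 ≤ 7560 * n.choose 11 := by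
      have h5 : 1820 * ((21168 + 448254) * n ^ 5) ≤ 1820 * (7560 * n.choose 11) := by
        calc 1820 * ((21168 + 448254) * n ^ 5) = (1820 * (21168 + 448254)) * n ^ 5 := by ring
          _ ≤ K * n ^ 5 := Nat.mul_le_mul_right _ (by rw [hK]; norm_num)
          _ ≤ _ := hYbig
      exact Nat.le_of_mul_le_mul_left h5 (by norm_num)
    exact hR34.trans (h2.trans hY)
  · -- (I2)
    have hL : (2 ^ (p + 4) - 2 * ∑ u ∈ Finset.range 5, (p + 4).choose u) *
        (7560 * n.choose 4 + (A3 - 7560 * (n - 3)) * s3 + (A4 - 7560) * s4 + (RSK d + (RBK d - RSK d)) * (d + 4).choose 5) +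
        (p + 4).choose 4 * (10584 * (s3 * (n - 3) + s4) + (RSK 10 * piAll + (RBK 10 - RSK 10) * piS0)) ≤
        K * n ^ 5 := by
      have h1 := Nat.mul_le_mul hphiNum hU
      have h2 : (p + 4).choose 4 * (10584 * (s3 * (n - 3) + s4) + (RSK 10 * piAll + (RBK 10 - RSK 10) * piS0)) ≤
          1820 * ((21168 + 448254) * n ^ 5) := Nat.mul_le_mul hDenU hR34
      have h3 : 65536 * (815166 * n ^ 5) + 1820 * ((21168 + 448254) * n ^ 5) = K * n ^ 5 := by rw [hK]; ring
      omega
    have hR : 1820 * (7560 * n.choose 11) ≤ (p + 4).choose 4 * (7560 * ∑ j ∈ Finset.Ico 5 p, n.choose j) :=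
      Nat.mul_le_mul hDenL hY
    exact hL.trans (hYbig.trans hR)

/-- **`cellOK8 p d` from the two tail inequalities** (symbolic `p`, corank `d ≥ 8`: the profile rate is `RBK d`, the
constant `0`; the per-flat branch of the `min` is what the tail bounds). -/
theorem cellOK8_of_tail_ineq (p d : ℕ) (h8 : 8 ≤ d)
    (h1 : 10584 * (min (d * (d + 1) / 2) ((d * d + 6 - 3 * d) / 2) * (p + d - 3) + min (min ((d + 3).choose 4) (d * (d + 1) * (d + 2) / 3)) (fourCircuitBound d)) +
        (RSK 10 * (min (d * (d + 1) / 2) ((d * d + 6 - 3 * d) / 2) * (p + d - 3).choose 2 + min (min ((d + 3).choose 4) (d * (d + 1) * (d + 2) / 3)) (fourCircuitBound d) * (p + d - 4) + (d + 4).choose 5) +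
          (RBK 10 - RSK 10) * (min (d * (d + 1) / 2) ((d * d + 6 - 3 * d) / 2) * (min (5 * d) (p + d) - 3).choose 2 + min (min ((d + 3).choose 4) (d * (d + 1) * (d + 2) / 3)) (fourCircuitBound d) * (min (5 * d) (p + d) - 4) + (d + 4).choose 5)) ≤
      7560 * ∑ j ∈ Finset.Ico 5 p, (p + d).choose j)
    (h2 : (2 ^ (p + 4) - 2 * ∑ u ∈ Finset.range 5, (p + 4).choose u) *
        (7560 * (p + d).choose 4 +
          (RSK d * (p + d - 3).choose 2 + (RBK d - RSK d) * (min (5 * d) (p + d) - 3).choose 2 - 7560 * (p + d - 3)) *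
            min (d * (d + 1) / 2) ((d * d + 6 - 3 * d) / 2) +
          (RSK d * (p + d - 4) + (RBK d - RSK d) * (min (5 * d) (p + d) - 4) - 7560) *
            min (min ((d + 3).choose 4) (d * (d + 1) * (d + 2) / 3)) (fourCircuitBound d) +
          (RSK d + (RBK d - RSK d)) * (d + 4).choose 5) +
      (p + 4).choose 4 *
        (10584 * (min (d * (d + 1) / 2) ((d * d + 6 - 3 * d) / 2) * (p + d - 3) + min (min ((d + 3).choose 4) (d * (d + 1) * (d + 2) / 3)) (fourCircuitBound d)) +
          (RSK 10 * (min (d * (d + 1) / 2) ((d * d + 6 - 3 * d) / 2) * (p + d - 3).choose 2 + min (min ((d + 3).choose 4) (d * (d + 1) * (d + 2) / 3)) (fourCircuitBound d) * (p + d - 4) + (d + 4).choose 5) +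
            (RBK 10 - RSK 10) * (min (d * (d + 1) / 2) ((d * d + 6 - 3 * d) / 2) * (min (5 * d) (p + d) - 3).choose 2 + min (min ((d + 3).choose 4) (d * (d + 1) * (d + 2) / 3)) (fourCircuitBound d) * (min (5 * d) (p + d) - 4) + (d + 4).choose 5))) ≤
      (p + 4).choose 4 * (7560 * ∑ j ∈ Finset.Ico 5 p, (p + d).choose j)) :
    cellOK8 p d = true := by
  unfold cellOK8
  simp only [CoreRegimes.chooseF_eq]
  rw [RBab_of_eight_le h8, Kab_of_eight_le h8, Nat.add_zero]
  apply decide_eq_true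
  refine ⟨h1, ?_⟩
  have hmin := min_le_left
    (7560 * (p + d).choose 4 +
      (RSK d * (p + d - 3).choose 2 + (RBK d - RSK d) * (min (5 * d) (p + d) - 3).choose 2 - 7560 * (p + d - 3)) *
        min (d * (d + 1) / 2) ((d * d + 6 - 3 * d) / 2) +
      (RSK d * (p + d - 4) + (RBK d - RSK d) * (min (5 * d) (p + d) - 4) - 7560) *
        min (min ((d + 3).choose 4) (d * (d + 1) * (d + 2) / 3)) (fourCircuitBound d) +
      (RSK d + (RBK d - RSK d)) * (d + 4).choose 5)
    (7560 * ((p + d).choose 4 +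
      (∑ j ∈ Finset.range (d - 5 + 1), Nat.choose 2 j) *
        (min (d * (d + 1) / 2) ((d * d + 6 - 3 * d) / 2) * (p + d - 3).choose 2 + min (min ((d + 3).choose 4) (d * (d + 1) * (d + 2) / 3)) (fourCircuitBound d) * (p + d - 4) + (d + 4).choose 5) +
      ((∑ j ∈ Finset.range (d - 5 + 1), Nat.choose 5 j) - (∑ j ∈ Finset.range (d - 5 + 1), Nat.choose 2 j)) *
        (min (d * (d + 1) / 2) ((d * d + 6 - 3 * d) / 2) * (min (5 * d) (p + d) - 3).choose 2 + min (min ((d + 3).choose 4) (d * (d + 1) * (d + 2) / 3)) (fourCircuitBound d) * (min (5 * d) (p + d) - 4) + (d + 4).choose 5)))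
  calc _ ≤ _ := Nat.add_le_add_right (Nat.mul_le_mul_left _ hmin) _
    _ ≤ _ := h2

/-- **`cellOK8 12 d` holds for every `d ≥ 401`.** -/
theorem cellOK8_of_tail12 (d : ℕ) (hd : 401 ≤ d) : cellOK8 12 d = true := by
  obtain ⟨h1, h2⟩ := tailM12 12 d (le_refl _) (le_refl _) hd
  exact cellOK8_of_tail_ineq 12 d (by omega) h1 h2

/-- **THE ROW-`12` TABLES** (`cellOK8`, unconditional): the cells `(12, d)` for `9 ≤ d ≤ 15`; then `16 ≤ d ≤ 400` in four
kernel chunks of `≤ 100` cells. -/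
theorem table_12_9_15 : ∀ d < 16, 9 ≤ d → cellOK8 12 d = true := by
  decide +kernel

/-- The cells `(12, 16 … 100)`. -/
theorem table_12_16_100 : ∀ d < 101, 16 ≤ d → cellOK8 12 d = true := by
  decide +kernel

/-- The cells `(12, 101 … 200)`. -/
theorem table_12_101_200 : ∀ d < 201, 101 ≤ d → cellOK8 12 d = true := by
  decide +kernel

/-- The cells `(12, 201 … 300)`. -/
theorem table_12_201_300 : ∀ d < 301, 201 ≤ d → cellOK8 12 d = true := by
  decide +kernel

/-- The cells `(12, 301 … 400)`. -/
theorem table_12_301_400 : ∀ d < 401, 301 ≤ d → cellOK8 12 d = true := by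
  decide +kernel

/-- The cells `(12, d)`, `9 ≤ d ≤ 400`, assembled. -/
theorem table_12_9_400 : ∀ d < 401, 9 ≤ d → cellOK8 12 d = true := by
  intro d hd h9
  rcases Nat.lt_or_ge d 16 with h | h
  · exact table_12_9_15 d h h9
  rcases Nat.lt_or_ge d 101 with h' | h'
  · exact table_12_16_100 d h' h
  rcases Nat.lt_or_ge d 201 with h'' | h''
  · exact table_12_101_200 d h'' h'
  rcases Nat.lt_or_ge d 301 with h''' | h'''
  · exact table_12_201_300 d h''' h''
  · exact table_12_301_400 d hd h'''

/-- **THE CORE OF RANK `12`, CONDITIONAL ON THE COMPUTED CAPS**: every `e`-free core of rank `12` satisfies C-025 at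
level `4`, provided the cores of corank `5` have `s₃ ≤ 7` and `s₄ ≤ 29` and the cores of corank `6` have `s₄ ≤ 45`
(the caps `P(5) = 7` — p3's `HypergraphBound 5 7` — and `Σ_{j ≤ 5} Q*(j) = 29`, `Σ_{j ≤ 6} Q*(j) = 45` — p1's
`FourCapSpec` instances; stated here as hypotheses on `M` itself, in the cell's own vocabulary). The cells `(12, 7)`
and `(12, 8)` are the unconditional sub-case cells; `d ≥ 9` is `cellOK8`. -/
theorem c025_core_four_twelve_of_caps (M : Matroid α) [M.Finite] (hR : M.eRank = (12 : ℕ)) (hbig : 12 + 4 < M.E.ncard)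
    (hfree : ∀ e ∈ M.E, ∃ A ⊆ M.E \ {e}, e ∉ M.closure A ∧ e ∉ M.closure ((M.E \ {e}) \ A))
    (hcap5 : M.E.ncard = 17 → {C : Set α | M.IsCircuit C ∧ C.ncard = 3}.ncard ≤ 7 ∧
      {C : Set α | M.IsCircuit C ∧ C.ncard = 4}.ncard ≤ 29)
    (hcap6 : M.E.ncard = 18 → {C : Set α | M.IsCircuit C ∧ C.ncard = 4}.ncard ≤ 45) :
    ThmN.RLS M 12 4 := by
  set d := M.E.ncard - 12 with hd
  have hn : M.E.ncard = 12 + d := by omega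
  rcases Nat.lt_or_ge d 6 with h5 | h6
  · -- `d = 5`: the capped cell `(12, 5)`
    have hd5 : d = 5 := by omega
    obtain ⟨hP, hS⟩ := hcap5 (by omega)
    exact rls_of_cellOK10 M 12 d 7 29 (by omega) hR hn hfree hP hS (by norm_num) (hd5 ▸ cell_twelve_five_caps)
  rcases Nat.lt_or_ge d 7 with h6' | h7
  · -- `d = 6`: the capped cell `(12, 6)`, with `s₃ ≤ 12` from Lemma T⁺⁺⁺
    have hd6 : d = 6 := by omega
    have hS := hcap6 (by omega)
    -- `s₃ ≤ 12`
    have hL : ∀ e ∈ M.E, ¬ M.IsLoop e := ThmN.not_isLoop_of_free M hfree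
    have hline : ∀ L ⊆ M.E, M.eRk L ≤ 2 → L.ncard ≤ 3 := by
      intro L hL' hr
      have := ThmN.ncard_add_one_le_two_pow_of_eRk_le M hL hfree 2 L hL' hr
      omega
    have hplane : ∀ P ⊆ M.E, M.eRk P ≤ 3 → P.ncard ≤ 6 := fun P hP hr =>
      ThmN.ncard_le_six_of_eRk_le_three_of_free M hfree hP hr
    have hdd : M.E.encard = M.eRank + d := by
      rw [hR, ← M.ground_finite.cast_ncard_eq, hn]
      push_cast
      ring
    have h2 := two_mul_ncard_triangles_add_three_mul_le_of_four_le M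
      (fun L hL hr => hline L hL hr.le) hplane (by omega) hdd
    have hP : {C : Set α | M.IsCircuit C ∧ C.ncard = 3}.ncard ≤ 12 := by
      have h2' : 2 * {C : Set α | M.IsCircuit C ∧ C.ncard = 3}.ncard + 3 * d ≤ d * d + 6 := h2
      rw [hd6] at h2'
      omega
    exact rls_of_cellOK10 M 12 d 12 45 (by omega) hR hn hfree hP hS (by norm_num) (hd6 ▸ cell_twelve_six_caps)
  rcases Nat.lt_or_ge d 8 with h7' | h8
  · exact c025_core_twelve_seven M hR (by omega) hfree
  rcases Nat.lt_or_ge d 9 with h8' | h9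
  · exact c025_core_twelve_eight M hR (by omega) hfree
  rcases Nat.lt_or_ge d 401 with h401 | h401
  · exact rls_of_cellOK8 M 12 d (by omega) hR hn hfree (by norm_num) (table_12_9_400 d h401 h9)
  · exact rls_of_cellOK8 M 12 d (by omega) hR hn hfree (by norm_num) (cellOK8_of_tail12 d h401)

/-- **LEVEL `4` AT RANK `12`, MODULO THE COMPUTED CAPS** (the fixed-rank frame): for every finite matroid on `α`,
provided every `e`-free core on `α` of corank `5` has `s₃ ≤ 7` and `s₄ ≤ 29` and every one of corank `6` has `s₄ ≤ 45`. -/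
theorem c025_four_twelve_fixed_of_caps
    (hcap5 : ∀ (N : Matroid α) [N.Finite],
      (∀ e ∈ N.E, ∃ A ⊆ N.E \ {e}, e ∉ N.closure A ∧ e ∉ N.closure ((N.E \ {e}) \ A)) →
      N.E.encard = N.eRank + ((5 : ℕ) : ℕ∞) →
      {C : Set α | N.IsCircuit C ∧ C.ncard = 3}.ncard ≤ 7 ∧ {C : Set α | N.IsCircuit C ∧ C.ncard = 4}.ncard ≤ 29)
    (hcap6 : ∀ (N : Matroid α) [N.Finite],
      (∀ e ∈ N.E, ∃ A ⊆ N.E \ {e}, e ∉ N.closure A ∧ e ∉ N.closure ((N.E \ {e}) \ A)) →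
      N.E.encard = N.eRank + ((6 : ℕ) : ℕ∞) → {C : Set α | N.IsCircuit C ∧ C.ncard = 4}.ncard ≤ 45)
    (M : Matroid α) [M.Finite] : ThmN.RLS M 12 4 := by
  refine rls_succ_fixed (α := α) 3 4 12 (by omega) ?_ ?_ ?_ M
  · intro M' _
    exact SevenThree.c025_three_all M' 11 (by omega)
  · intro M' _ hn
    rcases Nat.lt_or_ge M'.E.ncard (12 + 4) with h | h
    · exact ThmN.RLS_of_ncard_lt M' h
    · exact ThmN.RLS_of_ncard_eq M' (by omega)
  · intro M' _ hR hbig hfree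
    refine c025_core_four_twelve_of_caps M' hR hbig hfree ?_ ?_
    · intro h17
      refine hcap5 M' hfree ?_
      rw [hR, ← M'.ground_finite.cast_ncard_eq, h17]
      push_cast
      ring
    · intro h18
      refine hcap6 M' hfree ?_
      rw [hR, ← M'.ground_finite.cast_ncard_eq, h18]
      push_cast
      ring

/-- **C-025 AT LEVEL `4` FOR EVERY `p ≥ 12`, MODULO THE COMPUTED CAPS** (`p ≥ 13` is phase 9). -/
theorem c025_four_twelve_of_caps
    (hcap5 : ∀ (N : Matroid α) [N.Finite],
      (∀ e ∈ N.E, ∃ A ⊆ N.E \ {e}, e ∉ N.closure A ∧ e ∉ N.closure ((N.E \ {e}) \ A)) →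
      N.E.encard = N.eRank + ((5 : ℕ) : ℕ∞) →
      {C : Set α | N.IsCircuit C ∧ C.ncard = 3}.ncard ≤ 7 ∧ {C : Set α | N.IsCircuit C ∧ C.ncard = 4}.ncard ≤ 29)
    (hcap6 : ∀ (N : Matroid α) [N.Finite],
      (∀ e ∈ N.E, ∃ A ⊆ N.E \ {e}, e ∉ N.closure A ∧ e ∉ N.closure ((N.E \ {e}) \ A)) →
      N.E.encard = N.eRank + ((6 : ℕ) : ℕ∞) → {C : Set α | N.IsCircuit C ∧ C.ncard = 4}.ncard ≤ 45)
    (M : Matroid α) [M.Finite] (p : ℕ) (hp : 12 ≤ p) : ThmN.RLS M p 4 := by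
  rcases Nat.lt_or_ge p 13 with h | h
  · have hp12 : p = 12 := by omega
    subst hp12
    exact c025_four_twelve_fixed_of_caps hcap5 hcap6 M
  · exact c025_four_thirteen M p h

end S1

end PercRepro
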